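import Mathlib
import HarnessLib

/-!
# Venture HSemireg — the INDEPENDENT-TRANSVERSAL COUNT of a four-coordinate skeleton with LEVEL-UNIFORM margins (W5 seat w5-n6-2 gen 19)

Bookkeeping of the computation cell `pub-hsemireg`, group W5 (notes `widen/W5/N7-FEASIBILITY-w5n7.md` §3.1 (ROUTE A:
`A_r = k^r − m·Σ_{j=2}^r C(r,j) s_j k^{r−j}`), §3.6 (a)(b), §3.8 (a); `widen/W5/KERNEL-M-w5n62g19.md` §11; deposit
`widen/W5/n6code2/v22/count/`). Companion of `UniformMarginPhiLaw.lean` (same setting; there `K₄ − ΣpM`, here the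
class `[no torus]`); PLAIN, nothing of the tree imported or restated (Fubini steps and the pointwise expansion are
local `have`s).

SETTING (N7F §3.6 (a), LEMMA U). Four finite level types `A, B, C, D` with `t_A, …, t_D` levels, margin functions
`μ_X : X → R` with `Σ μ_X = m` on `A, B, C`, six torus matrices whose line sums through a level are that level's
margin (LEVEL-UNIFORM margins). `I = Σ_transversals Π (1 − x)` is the number of INDEPENDENT (torus-avoiding)
transversals for `0 ∕ 1` data; `p_X = Σ μ_X²`, `C_X = Σ μ_X³`, `B_XY = Σ μ_X·xXY·μ_Y`, `T_XYZ` the triangle sums,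
`ΣPaw` the twelve weighted triangle sums, `N(C₄), F₅, N(K₄)` the raw monomial sums of the three 4-cycles, the six
five-torus graphs and `K₄` (as in `UniformMarginPhiLaw`); `e_k(t)` the elementary symmetric functions of
`t_A, t_B, t_C, t_D`.

* `indepCount_margin` — INCLUSION–EXCLUSION with level-uniform margins (identity, commutative ring, arbitrary
  entries): `I = e₄(t) − m·e₂(t) + Σ_X (Σ_{W≠X} t_W)·p_X − Σ_{XYZ} t_W·T_XYZ + 3m² − 2ΣB − ΣC + ΣN(C₄) + ΣPaw −
  ΣF₅ + N(K₄)` (the 64 monomials of `Π(1 − x_e)`: the non-covering ones are pinned by the level counts and the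
  margins, the covering ones give `−c₄` with `c₄ := −3m² + 2ΣB + ΣC − ΣN(C₄) − ΣPaw + ΣF₅ − N(K₄)`, so that N7F
  §3.8 (a)'s printed 4-set identity reads `c₄ = m(s² − m)`).
* `indepCount_of_classEquations` — **THEOREM A₄⁺**: if moreover the four TRIANGLE LAWS `T_XYZ = p_X + p_Y + p_Z
  + m s` (N7F §3.6 (b)) and the 4-set identity (N7F §3.8 (a), as printed) hold, then
  `I = e₄(t) − m·e₂(t) − m s·e₁(t) − m(s² − m)` — the MARGINS DROP OUT. At `t_X = t` this is
  `t⁴ − m(6t² + 4st + s² − m) = A₄(t, m, s)`, the avoiding-transversal count of N7F §3.1 ROUTE A as printed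
  (`s₂ = 1`, `s₃ = s`, `s₄ = s² − m` against `e₂, e₁, e₀`), i.e. the flat `|S| = 4` class equation «`I = A₄`» used
  by `FlatIndependentTransversals.phi_law_of_independent_count` is the level-uniform one specialised, and for
  unequal level counts the K-secant avoiding count is the same polynomial with `C(4,j) t^{4−j} ↦ e_{4−j}(t)`.

HONEST FRAMING: finite sums and ring arithmetic only; the class equations are HYPOTHESES quoted as printed (that a
K-secant pure coordinate skeleton with level-uniform margins satisfies them is N7-FEASIBILITY's text). Nothing in
this file says that HC, HC_CM or HC_AV holds; no door ∕ tier ∕ report sentence of the cell is a consequence of this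
file alone.
-/

namespace Summit.Ventures.HSemireg
namespace UniformMarginIndependentCount
open Finset

variable {R : Type*} [CommRing R]
variable {A B C D : Type*} [Fintype A] [Fintype B] [Fintype C] [Fintype D]

set_option maxHeartbeats 400000 in
/-- **Inclusion–exclusion for independent transversals, level-uniform margins.** Level counts `tA … tD`, margins
`μA … μD` with totals `m` on `A, B, C`, six matrices whose line sums through a level are that level's margin.
Summed over transversals, `Π (1 − x)` equals `e₄(t) − m·e₂(t) + Σ_X (Σ_{W≠X} t_W)·p_X − Σ t_W·T_XYZ + 3m² −
2ΣB − ΣC + ΣN(C₄) + ΣPaw − ΣF₅ + N(K₄)`, every sum written in the shape the summation leaves it. -/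
theorem indepCount_margin (tA tB tC tD m : R) (μA : A → R) (μB : B → R) (μC : C → R) (μD : D → R)
    (xAB : A → B → R) (xAC : A → C → R) (xAD : A → D → R)
    (xBC : B → C → R) (xBD : B → D → R) (xCD : C → D → R)
    (hA : (Fintype.card A : R) = tA) (hB : (Fintype.card B : R) = tB)
    (hC : (Fintype.card C : R) = tC) (hD : (Fintype.card D : R) = tD)
    (hmA : ∑ a, μA a = m) (hmB : ∑ b, μB b = m) (hmC : ∑ c, μC c = m)
    (rAB : ∀ a, ∑ b, xAB a b = μA a) (cAB : ∀ b, ∑ a, xAB a b = μB b)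
    (rAC : ∀ a, ∑ c, xAC a c = μA a) (cAC : ∀ c, ∑ a, xAC a c = μC c)
    (rAD : ∀ a, ∑ e, xAD a e = μA a) (cAD : ∀ e, ∑ a, xAD a e = μD e)
    (rBC : ∀ b, ∑ c, xBC b c = μB b) (cBC : ∀ c, ∑ b, xBC b c = μC c)
    (rBD : ∀ b, ∑ e, xBD b e = μB b) (cBD : ∀ e, ∑ b, xBD b e = μD e)
    (rCD : ∀ c, ∑ e, xCD c e = μC c) (cCD : ∀ e, ∑ c, xCD c e = μD e) :
    ∑ a, ∑ b, ∑ c, ∑ e,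
      (1 - xAB a b) * (1 - xAC a c) * (1 - xAD a e) * (1 - xBC b c) * (1 - xBD b e) * (1 - xCD c e)
      = tA * tB * tC * tD
        - m * (tC * tD + tB * tD + tB * tC + tA * tD + tA * tC + tA * tB)
        + ((tB + tC + tD) * (∑ a, μA a * μA a) + (tA + tC + tD) * (∑ b, μB b * μB b)
          + (tA + tB + tD) * (∑ c, μC c * μC c) + (tA + tB + tC) * (∑ e, μD e * μD e))
        - (tD * (∑ a, ∑ b, ∑ c, xAB a b * xAC a c * xBC b c)
          + tC * (∑ a, ∑ b, ∑ e, xAB a b * xAD a e * xBD b e)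
          + tB * (∑ a, ∑ c, ∑ e, xAC a c * xAD a e * xCD c e)
          + tA * (∑ b, ∑ c, ∑ e, xBC b c * xBD b e * xCD c e))
        + 3 * m ^ 2
        - 2 * ((∑ a, ∑ b, μA a * xAB a b * μB b) + (∑ a, ∑ c, μA a * xAC a c * μC c)
          + (∑ a, ∑ e, μA a * xAD a e * μD e) + (∑ b, ∑ c, μB b * xBC b c * μC c)
          + (∑ b, ∑ e, μB b * xBD b e * μD e) + (∑ c, ∑ e, μC c * xCD c e * μD e))
        - ((∑ a, μA a * μA a * μA a) + (∑ b, μB b * μB b * μB b)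
          + (∑ c, μC c * μC c * μC c) + (∑ e, μD e * μD e * μD e))
        + ((∑ a, ∑ b, ∑ c, ∑ e, xAB a b * xAD a e * xBC b c * xCD c e)
          + (∑ a, ∑ b, ∑ c, ∑ e, xAB a b * xAC a c * xBD b e * xCD c e)
          + (∑ a, ∑ b, ∑ c, ∑ e, xAC a c * xAD a e * xBC b c * xBD b e))
        + ((∑ a, (∑ b, ∑ c, xAB a b * xAC a c * xBC b c) * μA a)
          + (∑ a, ∑ b, (∑ c, xAB a b * xAC a c * xBC b c) * μB b)
          + (∑ a, ∑ b, ∑ c, xAB a b * xAC a c * xBC b c * μC c)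
          + (∑ a, (∑ b, ∑ e, xAB a b * xAD a e * xBD b e) * μA a)
          + (∑ a, ∑ b, (∑ e, xAB a b * xAD a e * xBD b e) * μB b)
          + (∑ a, ∑ b, ∑ e, xAB a b * xAD a e * xBD b e * μD e)
          + (∑ a, (∑ c, ∑ e, xAC a c * xAD a e * xCD c e) * μA a)
          + (∑ a, ∑ c, (∑ e, xAC a c * xAD a e * xCD c e) * μC c)
          + (∑ a, ∑ c, ∑ e, xAC a c * xAD a e * xCD c e * μD e)
          + (∑ b, (∑ c, ∑ e, xBC b c * xBD b e * xCD c e) * μB b)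
          + (∑ b, ∑ c, (∑ e, xBC b c * xBD b e * xCD c e) * μC c)
          + (∑ b, ∑ c, ∑ e, xBC b c * xBD b e * xCD c e * μD e))
        - ((∑ a, ∑ b, ∑ c, ∑ e, xAC a c * xAD a e * xBC b c * xBD b e * xCD c e)
          + (∑ a, ∑ b, ∑ c, ∑ e, xAB a b * xAD a e * xBC b c * xBD b e * xCD c e)
          + (∑ a, ∑ b, ∑ c, ∑ e, xAB a b * xAC a c * xBC b c * xBD b e * xCD c e)
          + (∑ a, ∑ b, ∑ c, ∑ e, xAB a b * xAC a c * xAD a e * xBD b e * xCD c e)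
          + (∑ a, ∑ b, ∑ c, ∑ e, xAB a b * xAC a c * xAD a e * xBC b c * xCD c e)
          + (∑ a, ∑ b, ∑ c, ∑ e, xAB a b * xAC a c * xAD a e * xBC b c * xBD b e))
        + (∑ a, ∑ b, ∑ c, ∑ e, xAB a b * xAC a c * xAD a e * xBC b c * xBD b e * xCD c e) := by
  -- Fubini, local (leaves-first orders)
  have sum4_swap12 : ∀ f : A → B → C → D → R,
      ∑ a, ∑ b, ∑ c, ∑ e, f a b c e = ∑ b, ∑ a, ∑ c, ∑ e, f a b c e := fun f => Finset.sum_comm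
  have sum4_out3 : ∀ f : A → B → C → D → R,
      ∑ a, ∑ b, ∑ c, ∑ e, f a b c e = ∑ c, ∑ a, ∑ b, ∑ e, f a b c e :=
    fun f => (Finset.sum_congr rfl fun _ _ => Finset.sum_comm).trans Finset.sum_comm
  have sum4_out4 : ∀ f : A → B → C → D → R,
      ∑ a, ∑ b, ∑ c, ∑ e, f a b c e = ∑ e, ∑ a, ∑ b, ∑ c, f a b c e :=
    fun f => (Finset.sum_congr rfl fun _ _ =>
      (Finset.sum_congr rfl fun _ _ => Finset.sum_comm).trans Finset.sum_comm).trans Finset.sum_comm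
  have sum4_swap34 : ∀ f : A → B → C → D → R,
      ∑ a, ∑ b, ∑ c, ∑ e, f a b c e = ∑ a, ∑ b, ∑ e, ∑ c, f a b c e :=
    fun f => Finset.sum_congr rfl fun _ _ => Finset.sum_congr rfl fun _ _ => Finset.sum_comm
  have sum4_in2 : ∀ f : A → B → C → D → R,
      ∑ a, ∑ b, ∑ c, ∑ e, f a b c e = ∑ a, ∑ c, ∑ e, ∑ b, f a b c e :=
    fun f => Finset.sum_congr rfl fun _ _ =>
      Finset.sum_comm.trans (Finset.sum_congr rfl fun _ _ => Finset.sum_comm)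
  have sum4_in1 : ∀ f : A → B → C → D → R,
      ∑ a, ∑ b, ∑ c, ∑ e, f a b c e = ∑ b, ∑ c, ∑ e, ∑ a, f a b c e :=
    fun f => Finset.sum_comm.trans (Finset.sum_congr rfl fun _ _ =>
      Finset.sum_comm.trans (Finset.sum_congr rfl fun _ _ => Finset.sum_comm))
  have sum4_ae : ∀ f : A → B → C → D → R,
      ∑ a, ∑ b, ∑ c, ∑ e, f a b c e = ∑ a, ∑ e, ∑ b, ∑ c, f a b c e :=
    fun f => Finset.sum_congr rfl fun _ _ =>
      (Finset.sum_congr rfl fun _ _ => Finset.sum_comm).trans Finset.sum_comm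
  have sum4_be : ∀ f : A → B → C → D → R,
      ∑ a, ∑ b, ∑ c, ∑ e, f a b c e = ∑ b, ∑ e, ∑ c, ∑ a, f a b c e :=
    fun f => (sum4_in1 f).trans (Finset.sum_congr rfl fun _ _ => Finset.sum_comm)
  have sum4_ce : ∀ f : A → B → C → D → R,
      ∑ a, ∑ b, ∑ c, ∑ e, f a b c e = ∑ c, ∑ e, ∑ b, ∑ a, f a b c e :=
    fun f => (sum4_in1 f).trans
      (Finset.sum_comm.trans (Finset.sum_congr rfl fun _ _ => Finset.sum_comm))
  -- the 64 monomials of `Π (1 − x_e)`, grouped by graph type (signs `(−1)^|S|`), each written in the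
  -- factor order in which it is summed out (3-paths ends-outside, paws pendant-last)
  have hpt : ∀ x1 x2 x3 x4 x5 x6 : R,
      (1 - x1) * (1 - x2) * (1 - x3) * (1 - x4) * (1 - x5) * (1 - x6)
      = 1 - (x1 + x2 + x3 + x4 + x5 + x6)
        + (x1 * x2 + x1 * x3 + x2 * x3 + x1 * x4 + x1 * x5 + x4 * x5 + x2 * x4 + x2 * x6 + x4 * x6
          + x3 * x5 + x3 * x6 + x5 * x6)
        + (x1 * x6 + x2 * x5 + x3 * x4)
        - (x1 * x2 * x4 + x1 * x3 * x5 + x2 * x3 * x6 + x4 * x5 * x6)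
        - (x1 * x2 * x3 + x1 * x4 * x5 + x2 * x4 * x6 + x3 * x5 * x6)
        - (x2 * x1 * x5 + x3 * x1 * x4 + x1 * x2 * x6 + x3 * x2 * x4 + x1 * x3 * x6 + x2 * x3 * x5
          + x1 * x4 * x6 + x5 * x4 * x2 + x1 * x5 * x6 + x4 * x5 * x3 + x2 * x6 * x5 + x4 * x6 * x3)
        + (x1 * x2 * x4 * x3 + x1 * x2 * x4 * x5 + x1 * x2 * x4 * x6 + x1 * x3 * x5 * x2
          + x1 * x3 * x5 * x4 + x1 * x3 * x5 * x6 + x2 * x3 * x6 * x1 + x2 * x3 * x6 * x4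
          + x2 * x3 * x6 * x5 + x4 * x5 * x6 * x1 + x4 * x5 * x6 * x2 + x4 * x5 * x6 * x3)
        + (x1 * x3 * x4 * x6 + x1 * x2 * x5 * x6 + x2 * x3 * x4 * x5)
        - (x2 * x3 * x4 * x5 * x6 + x1 * x3 * x4 * x5 * x6 + x1 * x2 * x4 * x5 * x6
          + x1 * x2 * x3 * x5 * x6 + x1 * x2 * x3 * x4 * x6 + x1 * x2 * x3 * x4 * x5)
        + (x1 * x2 * x3 * x4 * x5 * x6) := by
    intros; ring
  simp_rw [hpt]
  -- 64 monomials under four binders: the split needs more than simp's default 100 000 steps (no heartbeat change)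
  simp (maxSteps := 400000) only [sum_add_distrib, sum_sub_distrib]
  -- leaves first
  rw [sum4_swap12 fun a b c _ => xAB a b * xBC b c, sum4_swap12 fun a b _ e => xAB a b * xBD b e,
    sum4_out3 fun a b c _ => xAC a c * xBC b c, sum4_out3 fun a _ c e => xAC a c * xCD c e,
    sum4_out3 fun _ b c e => xBC b c * xCD c e,
    sum4_out4 fun a b _ e => xAD a e * xBD b e, sum4_out4 fun a _ c e => xAD a e * xCD c e,
    sum4_out4 fun _ b c e => xBD b e * xCD c e,
    sum4_swap12 fun a b c e => xAB a b * xBC b c * xBD b e,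
    sum4_out3 fun a b c e => xAC a c * xBC b c * xCD c e,
    sum4_out4 fun a b c e => xAD a e * xBD b e * xCD c e,
    sum4_in2 fun a b c e => xAB a b * xAC a c * xCD c e,
    sum4_in2 fun a b c e => xAD a e * xAC a c * xBC b c,
    sum4_ae fun a b c e => xAB a b * xAD a e * xCD c e,
    sum4_ae fun a b c e => xAC a c * xAD a e * xBD b e,
    sum4_in1 fun a b c e => xAB a b * xBC b c * xCD c e,
    sum4_in1 fun a b c e => xBD b e * xBC b c * xAC a c,
    sum4_be fun a b c e => xAB a b * xBD b e * xCD c e,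
    sum4_be fun a b c e => xBC b c * xBD b e * xAD a e,
    sum4_ce fun a b c e => xAC a c * xCD c e * xBD b e,
    sum4_ce fun a b c e => xBC b c * xCD c e * xAD a e,
    sum4_swap34 fun a b c e => xAB a b * xAD a e * xBD b e * xCD c e,
    sum4_in2 fun a b c e => xAC a c * xAD a e * xCD c e * xBC b c,
    sum4_in2 fun a b c e => xAC a c * xAD a e * xCD c e * xBD b e,
    sum4_in1 fun a b c e => xBC b c * xBD b e * xCD c e * xAB a b,
    sum4_in1 fun a b c e => xBC b c * xBD b e * xCD c e * xAC a c,
    sum4_in1 fun a b c e => xBC b c * xBD b e * xCD c e * xAD a e]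
  simp only [sum_const, card_univ, nsmul_eq_mul, hA, hB, hC, hD, ← mul_sum, ← sum_mul,
    rAB, cAB, rAC, cAC, rAD, cAD, rBC, cBC, rBD, cBD, rCD, cCD, hmA, hmB, hmC]
  ring

/-- **THEOREM A₄⁺ — the independent-transversal count under the class equations.** Same data and a parameter
`s`. If the four TRIANGLE LAWS `T_XYZ = p_X + p_Y + p_Z + m s` (N7F §3.6 (b)) and the `|S| = 4` identity of
N7F §3.8 (a) hold as printed, then `Σ Π(1 − x) = e₄(t) − m·e₂(t) − m s·e₁(t) − m (s² − m)`: the margins drop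
out, and at `t_X = t` this is `A₄(t, m, s) = t⁴ − m (6t² + 4st + s² − m)` of N7F §3.1. -/
theorem indepCount_of_classEquations (s : R) (tA tB tC tD m : R) (μA : A → R) (μB : B → R) (μC : C → R) (μD : D → R)
    (xAB : A → B → R) (xAC : A → C → R) (xAD : A → D → R)
    (xBC : B → C → R) (xBD : B → D → R) (xCD : C → D → R)
    (hA : (Fintype.card A : R) = tA) (hB : (Fintype.card B : R) = tB)
    (hC : (Fintype.card C : R) = tC) (hD : (Fintype.card D : R) = tD)
    (hmA : ∑ a, μA a = m) (hmB : ∑ b, μB b = m) (hmC : ∑ c, μC c = m)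
    (rAB : ∀ a, ∑ b, xAB a b = μA a) (cAB : ∀ b, ∑ a, xAB a b = μB b)
    (rAC : ∀ a, ∑ c, xAC a c = μA a) (cAC : ∀ c, ∑ a, xAC a c = μC c)
    (rAD : ∀ a, ∑ e, xAD a e = μA a) (cAD : ∀ e, ∑ a, xAD a e = μD e)
    (rBC : ∀ b, ∑ c, xBC b c = μB b) (cBC : ∀ c, ∑ b, xBC b c = μC c)
    (rBD : ∀ b, ∑ e, xBD b e = μB b) (cBD : ∀ e, ∑ b, xBD b e = μD e)
    (rCD : ∀ c, ∑ e, xCD c e = μC c) (cCD : ∀ e, ∑ c, xCD c e = μD e)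
    (hTABC : (∑ a, ∑ b, ∑ c, xAB a b * xAC a c * xBC b c)
      = (∑ a, μA a * μA a) + (∑ b, μB b * μB b) + (∑ c, μC c * μC c) + m * s)
    (hTABD : (∑ a, ∑ b, ∑ e, xAB a b * xAD a e * xBD b e)
      = (∑ a, μA a * μA a) + (∑ b, μB b * μB b) + (∑ e, μD e * μD e) + m * s)
    (hTACD : (∑ a, ∑ c, ∑ e, xAC a c * xAD a e * xCD c e)
      = (∑ a, μA a * μA a) + (∑ c, μC c * μC c) + (∑ e, μD e * μD e) + m * s)
    (hTBCD : (∑ b, ∑ c, ∑ e, xBC b c * xBD b e * xCD c e)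
      = (∑ b, μB b * μB b) + (∑ c, μC c * μC c) + (∑ e, μD e * μD e) + m * s)
    (h4 : m * (s ^ 2 - m)
      = - 3 * m ^ 2
        + 2 * ((∑ a, ∑ b, μA a * xAB a b * μB b) + (∑ a, ∑ c, μA a * xAC a c * μC c)
          + (∑ a, ∑ e, μA a * xAD a e * μD e) + (∑ b, ∑ c, μB b * xBC b c * μC c)
          + (∑ b, ∑ e, μB b * xBD b e * μD e) + (∑ c, ∑ e, μC c * xCD c e * μD e))
        + ((∑ a, μA a * μA a * μA a) + (∑ b, μB b * μB b * μB b)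
          + (∑ c, μC c * μC c * μC c) + (∑ e, μD e * μD e * μD e))
        - ((∑ a, ∑ b, ∑ c, ∑ e, xAB a b * xAD a e * xBC b c * xCD c e)
          + (∑ a, ∑ b, ∑ c, ∑ e, xAB a b * xAC a c * xBD b e * xCD c e)
          + (∑ a, ∑ b, ∑ c, ∑ e, xAC a c * xAD a e * xBC b c * xBD b e))
        - ((∑ a, (∑ b, ∑ c, xAB a b * xAC a c * xBC b c) * μA a)
          + (∑ a, ∑ b, (∑ c, xAB a b * xAC a c * xBC b c) * μB b)
          + (∑ a, ∑ b, ∑ c, xAB a b * xAC a c * xBC b c * μC c)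
          + (∑ a, (∑ b, ∑ e, xAB a b * xAD a e * xBD b e) * μA a)
          + (∑ a, ∑ b, (∑ e, xAB a b * xAD a e * xBD b e) * μB b)
          + (∑ a, ∑ b, ∑ e, xAB a b * xAD a e * xBD b e * μD e)
          + (∑ a, (∑ c, ∑ e, xAC a c * xAD a e * xCD c e) * μA a)
          + (∑ a, ∑ c, (∑ e, xAC a c * xAD a e * xCD c e) * μC c)
          + (∑ a, ∑ c, ∑ e, xAC a c * xAD a e * xCD c e * μD e)
          + (∑ b, (∑ c, ∑ e, xBC b c * xBD b e * xCD c e) * μB b)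
          + (∑ b, ∑ c, (∑ e, xBC b c * xBD b e * xCD c e) * μC c)
          + (∑ b, ∑ c, ∑ e, xBC b c * xBD b e * xCD c e * μD e))
        + ((∑ a, ∑ b, ∑ c, ∑ e, xAC a c * xAD a e * xBC b c * xBD b e * xCD c e)
          + (∑ a, ∑ b, ∑ c, ∑ e, xAB a b * xAD a e * xBC b c * xBD b e * xCD c e)
          + (∑ a, ∑ b, ∑ c, ∑ e, xAB a b * xAC a c * xBC b c * xBD b e * xCD c e)
          + (∑ a, ∑ b, ∑ c, ∑ e, xAB a b * xAC a c * xAD a e * xBD b e * xCD c e)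
          + (∑ a, ∑ b, ∑ c, ∑ e, xAB a b * xAC a c * xAD a e * xBC b c * xCD c e)
          + (∑ a, ∑ b, ∑ c, ∑ e, xAB a b * xAC a c * xAD a e * xBC b c * xBD b e))
        - (∑ a, ∑ b, ∑ c, ∑ e, xAB a b * xAC a c * xAD a e * xBC b c * xBD b e * xCD c e)) :
    ∑ a, ∑ b, ∑ c, ∑ e,
      (1 - xAB a b) * (1 - xAC a c) * (1 - xAD a e) * (1 - xBC b c) * (1 - xBD b e) * (1 - xCD c e)
      = tA * tB * tC * tD - m * (tC * tD + tB * tD + tB * tC + tA * tD + tA * tC + tA * tB)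
        - m * s * (tA + tB + tC + tD) - m * (s ^ 2 - m) := by
  have hI := indepCount_margin tA tB tC tD m μA μB μC μD xAB xAC xAD xBC xBD xCD hA hB hC hD hmA hmB hmC
    rAB cAB rAC cAC rAD cAD rBC cBC rBD cBD rCD cCD
  linear_combination hI - tD * hTABC - tC * hTABD - tB * hTACD - tA * hTBCD + h4

end UniformMarginIndependentCount
end Summit.Ventures.HSemireg
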